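/-
Copyright (c) 2026 the pub-hodgecm-mathlib formalisation cell (harness21).  Prover seat hodgecm-mathlib-K2E1-p15 (g3), Track B ∕ K2-LIT, h413 = `stmt-HodgeConjecture-24833`,
R90-TF section S8 «ContSpec-n½», socket B MID :358, deal «(V) OF RECORD» (S8-R18x): ★ p863385 `resGMidBlock_ne_bot_assembly` with row (i)'s continuation rows FED BY NAME from the
NAMED witness exports (★ p863928 `witnessExports_spec`, ★ p863748) — ED. 1: `Ec := witnessEc·Θ`, `hE2 hEd hE4 hEbd hφ hφc` DISCHARGED; the pole ledger and the scalar ∕ operator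
roads stay VISIBLE, now as statements about the NAMED `witnessEc ∕ witnessP` (census `R90/S8/CENSUS-V-OfRecord.K2E1-p15-g3.md`).
-/
import Summits.HodgeConjecture.HodgeConjecture.Theorems.R90S8ResGMidBlockNeBotAssemblyU3        -- ★ p863385 (K2E2-p12): the (V) ASSEMBLY of letters
import Summits.HodgeConjecture.HodgeConjecture.Theorems.R90S8ChiPairExportsOfWitnessU3Defs     -- ★ p863928 (this seat): `witnessEc ∕ witnessP ∕ …`, `witnessExports_spec` (+ ★ p863748 `chiPair_rowsEdE4Ebd_of_poleLedger`)
import HarnessLib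

/-!
# S8 socket B MID — `R90S8ResGMidBlockNeBotOfRecordU3` (ED. 1): `LHalfNeZero (ξ.bcη⁻¹·μω) → resGMidBlock L μ ξ μω ≠ ⊥` with the (V) row (i) continuation data FED from the NAMED
# witness exports — `Ec := witnessEc·(ξ.ψ∘det)`; visible: the witness section + level facts, the POLE LEDGER about `witnessP ∕ witnessEc`, rows (ii)(iii)(i′)

Track B ∕ K2-LIT, crux h413 = `stmt-HodgeConjecture-24833`, route of record `HCCMUnconditional`; cell `hodgecm-mathlib`, R90-TF programme, section S8 «ContSpec-n½», socket B MID :358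
∕ (V).  THEOREMS ONLY (no `def`, no `instance`, no `notation`, no named-fact hypothesis, no `sorry`; default heartbeats); lane `--supports stmt-HodgeConjecture-24833 --as helper`
(count-neutral).  CLOSES NO SOCKET (OF-RECORD ≠ payment).  ★ p863385 `resGMidBlock_ne_bot_assembly` is called BY NAME with: the pair level character `ω := ω₀·Θ|_{K′}` (`Θ = detChar ξ.ψ`),
the pair section `φ := φ₀·Θ` (★ FILE A: `φ₀·Θ ∈ V((ξ.bcη⁻¹μω)·ψ̃⁻¹, 1·ξ.ψ; K′, ω₀·Θ)`, and `ψ̃ = pullback ξ.ψ = ξ.bcψ` by `rfl`), the continued family `Ec := witnessEc·Θ` with `hE2` (tube), `hEd`,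
`hE4`, `hEbd` from ★ `witnessExports_spec` + ★ `chiPair_rowsEdE4Ebd_of_poleLedger` under the ledger inclusion — so of ★ p863385's row (i) only the WITNESS DATA (`K′ ω₀ φ₀` + the exports'
level facts) and the POLE LEDGER (`Sp hSp`, `hSpP : {1<Re} ∖ Sp ⊆ (witnessP …)ᶜ`, `Fp hF hFE` at `3∕2` for `witnessEc·Θ`) remain visible; rows (ii) (`D … hE3 q qc P hqcq hPcd hqa hfac hφt g₀ hg₀ Cφt hφtbd`),
(iii) (`S T′ … A hA hsrc hA32`) and (i′) (`T hT Fam hFd hFam hMS`) are ★ p863385's binders VERBATIM with `Ec ↦ witnessEc·Θ`, `φ ↦ φ₀·Θ`.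
VISIBLE → PAYER: witness data ⇐ K2E1-p11 (3c witness ★ p863746 + 2b conductor level); ledger ⇐ K2E2-p12; `hE3`∕`hfac` ⇐ ℓ-CT (K2E1-p12) + ★ (a-7)(a-8); `hsrc hA32` ⇐ C10-p07 ∕ CS-p03;
`Fam hFam` ⇐ hCONT (p16); `hMS` ★ modulo it (★ p863403 chain).
HONEST LABEL: HC_CM is proved only modulo the 7 printed citations (2 remaining named inputs: hLiu418 = `stmt-HodgeConjecture-24832`, h413 = `stmt-HodgeConjecture-24833`) until
rung 0 closes; OF-RECORD ≠ payment — :358 stays `sorry` in B until every visible row is ★ and instantiated; REL ≠ ★ ≠ WRITTEN ≠ BUILT; count-neutral.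

## References
* [Rogawski1990] J. D. Rogawski, *Automorphic Representations of Unitary Groups in Three Variables* (1990), §13.3 p. 202, §13.9 (ii) p. 229.
* [MoeglinWaldspurger1995] C. Mœglin, J.-L. Waldspurger, *Spectral Decomposition and Eisenstein Series* (1995), IV.1.8–IV.1.11, I.4.11.
* [BernsteinLapid2019] J. Bernstein, E. Lapid, *On the meromorphic continuation of Eisenstein series*, J. Amer. Math. Soc. 37 (2024), Thm 2.3.
-/

set_option autoImplicit false
set_option linter.dupNamespace false  -- the mandated namespace `…HodgeConjecture.HodgeConjecture.R90.S8` (LEAD #1 L1) repeats the summit's segment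

noncomputable section

open MeasureTheory Measure NumberField IsDedekindDomain Set Filter Topology Metric
open scoped ENNReal NNReal MatrixGroups
open Literature.MeasureTheory.Group Literature.NumberTheory
open Literature.NumberTheory.Automorphic Literature.NumberTheory.Automorphic.UnitaryGroup Literature.NumberTheory.LFunctions Literature.NumberTheory.GaloisRepresentations AdelicGroupData
open Literature.NumberTheory.Automorphic.Arthur2013.Leaves.TECR Literature.NumberTheory.Rogawski1990 ContRepresentation
open Summit.HodgeConjecture.HodgeConjecture.Cruxes.H413.K2E1BorelEisensteinU
open Summit.HodgeConjecture.HodgeConjecture.Cruxes.H413.K2E1BLBorelSpacesU2Defs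
open Summit.HodgeConjecture.HodgeConjecture.Cruxes.H413.K2E1BLBorelOperatorsU2Defs
open Summit.HodgeConjecture.HodgeConjecture.Cruxes.H413.K2E1CharacterEisensteinU2Defs
open Summit.HodgeConjecture.HodgeConjecture.Cruxes.H413.K2E1ChiSectionSpaceU2Defs
open Summit.HodgeConjecture.HodgeConjecture.Cruxes.H413.K2E1CharacterEisensteinU3PairDefs
open Summit.HodgeConjecture.HodgeConjecture.Cruxes.H413.K2E1ChiSectionSpaceU3PairDefs
open Summit.HodgeConjecture.HodgeConjecture.Cruxes.H413.K2E1HeckeLHalfNeZeroDefs (LHalfNeZero)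

namespace Summit.HodgeConjecture.HodgeConjecture.R90.S8

variable (L : Type) [Field L] [NumberField L] [IsCMField L]
  [MeasurableSpace (quasiSplit (↥(maximalRealSubfield L)) L (IsCMField.complexConj L) 3).Adelic] [BorelSpace (quasiSplit (↥(maximalRealSubfield L)) L (IsCMField.complexConj L) 3).Adelic]
  [MeasurableSpace (arch (↥(maximalRealSubfield L)) L (IsCMField.complexConj L) 3 ((StdForm.antidiagonal 3).over L))] [BorelSpace (arch (↥(maximalRealSubfield L)) L (IsCMField.complexConj L) 3 ((StdForm.antidiagonal 3).over L))]
  [MeasurableSpace (finAdelic (↥(maximalRealSubfield L)) L (IsCMField.complexConj L) 3 ((StdForm.antidiagonal 3).over L))] [BorelSpace (finAdelic (↥(maximalRealSubfield L)) L (IsCMField.complexConj L) 3 ((StdForm.antidiagonal 3).over L))]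

/-- **(V) OF RECORD, ED. 1 — `LHalfNeZero (ξ.bcη⁻¹·μω) → resGMidBlock L μ ξ μω ≠ ⊥`** with row (i)'s continuation data FED from the NAMED witness exports: ★ p863385 called BY NAME with
`ω := ω₀·Θ|_{K′}`, `φ := φ₀·Θ`, `Ec := witnessEc·Θ`, `hφ hφc hE2 hEd hE4 hEbd` discharged (★ `witnessExports_spec`, ★ `chiPair_rowsEdE4Ebd_of_poleLedger`); visible rows as listed in the
module docstring, the pole ledger now about the NAMED `witnessP ∕ witnessEc`. [cite: Rogawski1990, §13.9 (ii) p. 229] [cite: MoeglinWaldspurger1995, IV.1.11, I.4.11] -/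
theorem resGMidBlock_ne_bot_of_record
    (μ : Measure (quasiSplit (↥(maximalRealSubfield L)) L (IsCMField.complexConj L) 3).automorphicQuotient) [(quasiSplit (↥(maximalRealSubfield L)) L (IsCMField.complexConj L) 3).IsAutomorphicMeasure μ]
    (μω : HeckeCharacter L) (hμu : μω.IsUnitary)
    (hμω : ∀ x : ideleGroup ↥(maximalRealSubfield L), μω (AdeleRing.ideleBaseChange (↥(maximalRealSubfield L)) L x) = quadraticHeckeCharCM L x)
    (ξ : OneDimAutRepH L)
    -- the exports' structural data (Haar measures, fundamental domain, covering weight, CM frame facts)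
    (νG : Measure (quasiSplit (↥(maximalRealSubfield L)) L (IsCMField.complexConj L) 3).Adelic) [νG.IsHaarMeasure] [νG.IsInvInvariant] [SFinite νG]
    (ν : Measure ↥(adelicUnipotent (↥(maximalRealSubfield L)) L (IsCMField.complexConj L) 3)) [ν.IsHaarMeasure] [ν.IsMulRightInvariant] [ν.IsInvInvariant]
    {𝓕 : Set ↥(adelicUnipotent (↥(maximalRealSubfield L)) L (IsCMField.complexConj L) 3)}
    (h𝓕N : IsFundamentalDomain ↥(rationalUnipotent (↥(maximalRealSubfield L)) L (IsCMField.complexConj L) 3) 𝓕 ν) (h𝓕c : IsCompact (closure 𝓕)) (h𝓕₀ : ν 𝓕 ≠ 0)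
    {β : (quasiSplit (↥(maximalRealSubfield L)) L (IsCMField.complexConj L) 3).Adelic → ℝ≥0∞}
    (hβ : IsCoveringWeight ↥((arithmeticBorel (↥(maximalRealSubfield L)) L (IsCMField.complexConj L) 3).map (quasiSplit (↥(maximalRealSubfield L)) L (IsCMField.complexConj L) 3).arithmeticSubgroup.subtype) β)
    {μZ : Measure (borelQuotient (↥(maximalRealSubfield L)) L (IsCMField.complexConj L) 3)} [SFinite μZ]
    (hμZ : ∀ f : borelQuotient (↥(maximalRealSubfield L)) L (IsCMField.complexConj L) 3 → ℝ≥0∞, Measurable f → ∫⁻ z, f z ∂μZ = ∫⁻ g, β g * f (toBorelQuotient (↥(maximalRealSubfield L)) L (IsCMField.complexConj L) 3 g) ∂νG)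
    (μa : Measure (arch (↥(maximalRealSubfield L)) L (IsCMField.complexConj L) 3 ((StdForm.antidiagonal 3).over L))) [μa.IsHaarMeasure] [μa.IsMulRightInvariant]
    (μf : Measure (finAdelic (↥(maximalRealSubfield L)) L (IsCMField.complexConj L) 3 ((StdForm.antidiagonal 3).over L))) [μf.IsHaarMeasure]
    (h2 : Module.finrank (↥(maximalRealSubfield L)) L = 2) (hc : IsCMField.complexConj L ≠ 1) (hJ : ((StdForm.antidiagonal 3).over L).det ≠ 0)
    -- (i) VISIBLE: the UNTWISTED witness section `φ₀ ∈ V(ξ.bcη⁻¹·μω, K′, ω₀)` and the level facts the exports need (K2E1-p11's 3c ∕ 2b)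
    (K' : Subgroup (quasiSplit (↥(maximalRealSubfield L)) L (IsCMField.complexConj L) 3).Adelic) (ω₀ : ↥K' →* ℂ)
    {φ₀ : (quasiSplit (↥(maximalRealSubfield L)) L (IsCMField.complexConj L) 3).Adelic → ℂ} (hφ₀V : φ₀ ∈ chiSectionSpace (ξ.bcη⁻¹ * μω) K' (ω₀ : ↥K' → ℂ)) (hφ₀c : Continuous φ₀) {Mφ : ℝ} (hφ₀M : ∀ x, ‖φ₀ x‖ ≤ Mφ)
    (hK' : K' ≤ ((standardMaximalCompactGL 3 L).comap (adelicVal (↥(maximalRealSubfield L)) L (IsCMField.complexConj L) 3 ((StdForm.antidiagonal 3).over L)) : Subgroup (quasiSplit (↥(maximalRealSubfield L)) L (IsCMField.complexConj L) 3).Adelic))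
    (hKinf : ∀ k : arch (↥(maximalRealSubfield L)) L (IsCMField.complexConj L) 3 ((StdForm.antidiagonal 3).over L), adelicVal (↥(maximalRealSubfield L)) L (IsCMField.complexConj L) 3 ((StdForm.antidiagonal 3).over L) (archToAdelic (↥(maximalRealSubfield L)) L (IsCMField.complexConj L) 3 _ k) ∈ standardMaximalCompactGL 3 L →
      archToAdelic (↥(maximalRealSubfield L)) L (IsCMField.complexConj L) 3 _ k ∈ K')
    (U₀ : Subgroup (GL (Fin 3) (FiniteAdeleRing (𝓞 L) L))) (hU₀o : IsOpen (U₀ : Set (GL (Fin 3) (FiniteAdeleRing (𝓞 L) L)))) (hU₀c : IsCompact (U₀ : Set (GL (Fin 3) (FiniteAdeleRing (𝓞 L) L))))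
    (hU : ∀ b : finAdelic (↥(maximalRealSubfield L)) L (IsCMField.complexConj L) 3 ((StdForm.antidiagonal 3).over L), (b : GL (Fin 3) (FiniteAdeleRing (𝓞 L) L)) ∈ U₀ →
      ∃ hb : finAdelicToAdelic (↥(maximalRealSubfield L)) L (IsCMField.complexConj L) 3 ((StdForm.antidiagonal 3).over L) b ∈ K', (ω₀ : ↥K' → ℂ) ⟨_, hb⟩ = 1)
    (hVc : ∀ φ ∈ chiSectionSpace (ξ.bcη⁻¹ * μω) K' (ω₀ : ↥K' → ℂ), Continuous φ)
    {ι' : Type} [Fintype ι'] [DecidableEq ι'] (bV : Module.Basis ι' ℂ ↥(chiSectionSpace (reflectChar (IsCMField.complexConj L) (ξ.bcη⁻¹ * μω)) K' (ω₀ : ↥K' → ℂ)))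
    (hbc : ∀ j, Continuous ((bV j : ↥(chiSectionSpace (reflectChar (IsCMField.complexConj L) (ξ.bcη⁻¹ * μω)) K' (ω₀ : ↥K' → ℂ))) : (quasiSplit (↥(maximalRealSubfield L)) L (IsCMField.complexConj L) 3).Adelic → ℂ)) {Mb : ℝ}
    (hbM : ∀ j x, ‖((bV j : ↥(chiSectionSpace (reflectChar (IsCMField.complexConj L) (ξ.bcη⁻¹ * μω)) K' (ω₀ : ↥K' → ℂ))) : (quasiSplit (↥(maximalRealSubfield L)) L (IsCMField.complexConj L) 3).Adelic → ℂ) x‖ ≤ Mb)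
    -- (i) VISIBLE: the POLE LEDGER about the NAMED exports (K2E2-p12)
    (Sp : Finset ℂ) (hSp : ∀ s ∈ Sp, s.im = 0 ∧ 1 < s.re ∧ s.re ≤ 2)
    (hSpP : ({z : ℂ | 1 < z.re} \ (↑Sp : Set ℂ)) ⊆ (witnessP L μ νG ν h𝓕N h𝓕c h𝓕₀ hβ hμZ hφ₀V hφ₀c hφ₀M hK' hKinf U₀ hU₀o hU₀c hU hVc μa μf bV hbc hbM h2 hc hJ ξ.ψ ξ.hψ)ᶜ)
    (Fp : (quasiSplit (↥(maximalRealSubfield L)) L (IsCMField.complexConj L) 3).Adelic → ℂ → ℂ) (hF : ∀ g, AnalyticAt ℂ (Fp g) ((3 : ℂ) / 2))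
    (hFE : ∀ g, Fp g =ᶠ[𝓝[≠] ((3 : ℂ) / 2)] fun z => (z - (3 : ℂ) / 2) * (witnessEc L μ νG ν h𝓕N h𝓕c h𝓕₀ hβ hμZ hφ₀V hφ₀c hφ₀M hK' hKinf U₀ hU₀o hU₀c hU hVc μa μf bV hbc hbM h2 hc hJ ξ.ψ ξ.hψ z g * ((detChar (↥(maximalRealSubfield L)) L (IsCMField.complexConj L) h2 hc 3 ((StdForm.antidiagonal 3).over L) ξ.ψ ξ.hψ hJ g : ℂˣ) : ℂ)))
    -- (ii) ★ p863385's row (ii) VERBATIM (`Ec ↦ witnessEc·Θ`, `φ ↦ φ₀·Θ`)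
    {D : Set ℂ} (hDo : IsOpen D) (hD : ∀ᶠ z in 𝓝[≠] ((3 : ℂ) / 2), z ∈ D) (hDsub : D ⊆ {z : ℂ | 1 < z.re} \ (↑Sp : Set ℂ))
    (ψ φt : ℂ → (quasiSplit (↥(maximalRealSubfield L)) L (IsCMField.complexConj L) 3).Adelic → ℂ)
    (hE3 : ∀ z ∈ D, ∀ g : (quasiSplit (↥(maximalRealSubfield L)) L (IsCMField.complexConj L) 3).Adelic,
      borelConstantTerm ν 𝓕 (fun x => witnessEc L μ νG ν h𝓕N h𝓕c h𝓕₀ hβ hμZ hφ₀V hφ₀c hφ₀M hK' hKinf U₀ hU₀o hU₀c hU hVc μa μf bV hbc hbM h2 hc hJ ξ.ψ ξ.hψ z x * ((detChar (↥(maximalRealSubfield L)) L (IsCMField.complexConj L) h2 hc 3 ((StdForm.antidiagonal 3).over L) ξ.ψ ξ.hψ hJ x : ℂˣ) : ℂ)) g = (fun x => φ₀ x * ((detChar (↥(maximalRealSubfield L)) L (IsCMField.complexConj L) h2 hc 3 ((StdForm.antidiagonal 3).over L) ξ.ψ ξ.hψ hJ x : ℂˣ) : ℂ)) g * (((borelHeight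 g : ℝ≥0) : ℝ) : ℂ) ^ z + ψ z g * (((borelHeight g : ℝ≥0) : ℝ) : ℂ) ^ (2 - z))
    (q qc : ℂ → ℂ) {P : Set ℂ} (hqcq : ∀ z : ℂ, 2 < z.re → qc z = q z) (hPcd : ∀ z₀ : ℂ, ∀ᶠ s in 𝓝[≠] z₀, s ∉ P) (hqa : ∀ z : ℂ, z ∉ P → AnalyticAt ℂ qc z)
    (hfac : ∀ᶠ z in 𝓝[≠] ((3 : ℂ) / 2), ∀ g, ψ z g = qc z * φt z g) (hφt : ∀ g, ContinuousAt (fun z => φt z g) ((3 : ℂ) / 2))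
    {g₀ : (quasiSplit (↥(maximalRealSubfield L)) L (IsCMField.complexConj L) 3).Adelic} (hg₀ : φt ((3 : ℂ) / 2) g₀ ≠ 0) {Cφt : ℝ} (hφtbd : ∀ g, ‖φt ((3 : ℂ) / 2) g‖ ≤ Cφt)
    -- (iii) ★ p863385's row (iii) VERBATIM
    {S : Set (HeightOneSpectrum (𝓞 L))} {T' : Set (HeightOneSpectrum (𝓞 ↥(maximalRealSubfield L)))}
    (hS : S.Finite) (hurφ : ∀ w ∉ S, (ξ.bcη⁻¹ * μω).IsUnramifiedAt w) (hT' : T'.Finite) (hurη : ∀ v ∉ T', (1 : HeckeCharacter ↥(maximalRealSubfield L)).IsUnramifiedAt v)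
    (A : ℂ → ℂ) (hA : DifferentiableOn ℂ A {z : ℂ | 1 < z.re})
    (hsrc : ∀ z : ℂ, 2 < z.re → q z = A z *
          ((partialStandardL S (fun w => {(ξ.bcη⁻¹ * μω).valueAtUniformizer w}) (z - 1) * partialStandardL T' (fun v => {(1 : HeckeCharacter ↥(maximalRealSubfield L)).valueAtUniformizer v}) (2 * z - 2)) /
            (partialStandardL S (fun w => {(ξ.bcη⁻¹ * μω).valueAtUniformizer w}) z * partialStandardL T' (fun v => {(1 : HeckeCharacter ↥(maximalRealSubfield L)).valueAtUniformizer v}) (2 * z - 1))))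
    (hA32 : A (3 / 2) ≠ 0)
    -- (i′) ★ p863385's row (i′) VERBATIM (`Ec ↦ witnessEc·Θ`)
    {T : ℝ≥0} (hT : 1 ≤ T) (Fam : ℂ → (quasiSplit (↥(maximalRealSubfield L)) L (IsCMField.complexConj L) 3).L2 μ) (hFd : DifferentiableOn ℂ Fam D)
    (hFam : ∀ z ∈ D, ((Fam z : (quasiSplit (↥(maximalRealSubfield L)) L (IsCMField.complexConj L) 3).L2 μ) : (quasiSplit (↥(maximalRealSubfield L)) L (IsCMField.complexConj L) 3).automorphicQuotient → ℂ) =ᵐ[μ] (quasiSplit (↥(maximalRealSubfield L)) L (IsCMField.complexConj L) 3).quotFun (truncation ν 𝓕 T (fun x => witnessEc L μ νG ν h𝓕N h𝓕c h𝓕₀ hβ hμZ hφ₀V hφ₀c hφ₀M hK' hKinf U₀ hU₀o hU₀c hU hVc μa μf bV hbc hbM h2 hc hJ ξ.ψ ξ.hψ z x * ((detChar (↥(maximalRealSubfield L)) L (IsCMField.complexConj L) h2 hc 3 ((StdForm.antidiagonal 3).over L) ξ.ψ ξ.hψ hJ x : ℂˣ) : ℂ))))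
    (hMS : ∃ C : ℝ, ∀ᶠ z in 𝓝[≠] ((3 : ℂ) / 2), ‖(z - (3 : ℂ) / 2) • Fam z‖ ≤ C) :
    LHalfNeZero (ξ.bcη⁻¹ * μω) → resGMidBlock L μ ξ μω ≠ ⊥ := by
  intro hL
  -- the NAMED exports' clauses (★ p863928)
  obtain ⟨-, -, -, -, -, -, -, -, hmem, hcont, htube, -, hEdiff, hE4P, hEbdP⟩ := witnessExports_spec L μ νG ν h𝓕N h𝓕c h𝓕₀ hβ hμZ hφ₀V hφ₀c hφ₀M hK' hKinf U₀ hU₀o hU₀c hU hVc μa μf bV hbc hbM h2 hc hJ ξ.ψ ξ.hψ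
  -- rows `hEd hE4 hEbd` on the slit half-plane from the pole ledger (★ p863748 §2)
  obtain ⟨hEd, hE4, hEbd⟩ := chiPair_rowsEdE4Ebd_of_poleLedger L hEdiff hE4P hEbdP hSpP
  -- the pair level character `ω := ω₀·Θ|_K′` as a monoid hom
  let ω : ↥K' →* ℂ :=
    { toFun := fun k => ω₀ k * ((detChar (↥(maximalRealSubfield L)) L (IsCMField.complexConj L) h2 hc 3 ((StdForm.antidiagonal 3).over L) ξ.ψ ξ.hψ hJ (k : (quasiSplit (↥(maximalRealSubfield L)) L (IsCMField.complexConj L) 3).Adelic) : ℂˣ) : ℂ)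
      map_one' := by simp only [map_one, OneMemClass.coe_one, Units.val_one, mul_one]
      map_mul' := fun a b => by
        simp only [map_mul, Subgroup.coe_mul, Units.val_mul]
        ring }
  -- the pair section `φ₀·Θ` lies in `V(ξ.bcη⁻¹·ξ.bcψ⁻¹·μω, ξ.ψ; K′, ω)` (`pullback ξ.ψ = ξ.bcψ` by `rfl`, `1·ξ.ψ = ξ.ψ`)
  have hχ : (ξ.bcη⁻¹ * μω) * (TorusDict.pullback (IsCMField.complexConj L) h2 hc ξ.ψ ξ.hψ)⁻¹ = ξ.bcη⁻¹ * ξ.bcψ⁻¹ * μω := by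
    have hp : TorusDict.pullback (IsCMField.complexConj L) h2 hc ξ.ψ ξ.hψ = ξ.bcψ := rfl
    rw [hp, mul_right_comm]
  have h1 : (1 : ↥(TorusDict.torus (IsCMField.complexConj L)) →ₜ* ℂˣ) * ξ.ψ = ξ.ψ := one_mul ξ.ψ
  have e : chiSectionSpacePair ((ξ.bcη⁻¹ * μω) * (TorusDict.pullback (IsCMField.complexConj L) h2 hc ξ.ψ ξ.hψ)⁻¹)
        ((1 : ↥(TorusDict.torus (IsCMField.complexConj L)) →ₜ* ℂˣ) * ξ.ψ) K'
        (fun k => ω₀ k * ((detChar (↥(maximalRealSubfield L)) L (IsCMField.complexConj L) h2 hc 3 ((StdForm.antidiagonal 3).over L) ξ.ψ ξ.hψ hJ (k : (quasiSplit (↥(maximalRealSubfield L)) L (IsCMField.complexConj L) 3).Adelic) : ℂˣ) : ℂ)) =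
      chiSectionSpacePair (ξ.bcη⁻¹ * ξ.bcψ⁻¹ * μω) ξ.ψ K' (ω : ↥K' → ℂ) := by
    rw [hχ, h1]
    rfl
  have hφ : (fun x => φ₀ x * ((detChar (↥(maximalRealSubfield L)) L (IsCMField.complexConj L) h2 hc 3 ((StdForm.antidiagonal 3).over L) ξ.ψ ξ.hψ hJ x : ℂˣ) : ℂ)) ∈ chiSectionSpacePair (ξ.bcη⁻¹ * ξ.bcψ⁻¹ * μω) ξ.ψ K' (ω : ↥K' → ℂ) := e ▸ hmem
  exact resGMidBlock_ne_bot_assembly L μ μω hμu hμω ξ K' ω (fun x => φ₀ x * ((detChar (↥(maximalRealSubfield L)) L (IsCMField.complexConj L) h2 hc 3 ((StdForm.antidiagonal 3).over L) ξ.ψ ξ.hψ hJ x : ℂˣ) : ℂ)) hφ hcont (fun z x => witnessEc L μ νG ν h𝓕N h𝓕c h𝓕₀ hβ hμZ hφ₀V hφ₀c hφ₀M hK' hKinf U₀ hU₀o hU₀c hU hVc μa μf bV hbc hbM h2 hc hJ ξ.ψ ξ.hψ z x * ((detChar (↥(maximalRealSubfield L)) L (IsCMField.complexConj L) h2 hc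 3 ((StdForm.antidiagonal 3).over L) ξ.ψ ξ.hψ hJ x : ℂˣ) : ℂ)) Sp hSp hEd htube Fp hF hFE hE4 hEbd
    ν h𝓕N h𝓕c hDo hD hDsub ψ φt hE3 q qc hqcq hPcd hqa hfac hφt hg₀ hφtbd hS hurφ hT' hurη A hA hsrc hA32 hT Fam hFd hFam hMS hL

end Summit.HodgeConjecture.HodgeConjecture.R90.S8

end
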